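import Mathlib
import Summits.NavierStokesRegularity.NavierStokesRegularity.Theorems.FilamentSkeletonRssClause13PieceSymbolFacts

/-!
# Sketch — crux-ideate slot 3 gen 7 for `SkeletonJ1R` (stmt-NavierStokesRegularity-23610)
# Card `kelvin-slave-band-reduction`: eliminate the KELVIN band FIRST (slice-Picard contraction, slaved to the
# bending-band shape), then ONE Γ-uniform slice Newton–Kantorovich on the bending band.

Three first statements of the line, all over existing declarations:

* `SlicePicard` / `slicePicard_holds` (PROVED, 0 sorries) — the inner loop ("Kelvin slave"): if `g ↦ Φ(R g) − g` is
  `½`-Lipschitz on the closed ball `‖g‖ ≤ 2ε` of a Banach space and `‖Φ(R 0)‖ ≤ ε`, then `Φ ∘ R` has a zero of norm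
  `≤ 2ε`.  (Used with `Φ = χ_K ψ F(A + P + ·)` the HIGH-band in-ball tangency defect at the current analytic curve `A`,
  `R = R_K(A)` a polynomially bounded free-tail right inverse of its linearisation on the high band, `ε` the
  stretched-exponentially small high-band defect of an analytic curve; the Lipschitz constant is
  `‖R_K‖²·C_N·ε ≪ 1`.)  The outer loop is the landed `…Cruxes.SkeletonJ1R.FreeTailSliceNewton.sliceKantorovich_holds`
  on the product space `F_an × F_pl` (any Banach norm on the product — no new abstract statement needed).
* `BandSymbolFacts` / `bandSymbolFacts_holds` (PROVED, corollary of LANDED window theorems of the Clause-13 model lane: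
  `abs_liaSym_ge_low`, `liaSym_le_neg_mid_low`, `liaSym_le_neg_window`, `deriv_liaSym_ge_band_const`, `liaSym_ge_MID`) — the
  Γ-FREE zone structure of the exact static self-induction symbol `liaSym` (Kelvin multiplier `m = 2·liaSym`) that the split uses:
  (i) BENDING band `0 < x ≤ 1/4`: `x²/5 ≤ |liaSym x|` (elliptic floor ⇒ exact-symbol algebraic right inverse above ball scale,
  clamped LIA sweep `ClampedShootingBound` below it); (ii) KELVIN band `x ≥ 1/4` is covered by three windows — negative floor
  `liaSym ≤ −1/64` (algebraic zone), derivative floor `liaSym′ ≥ 153/4000` on `[17/20, 18/5]` ∋ κ* (TRANSIT zone: signed group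
  velocity `Ω μ m′ > 0`, outward-transport IVP inverse, gain `2ℓ/(Ω μ m′)`), positive floor `liaSym ≥ 1/50` (algebraic zone).
  So NO Γ-dependent band cut is needed: the seam sits at the fixed symbol value `x = kμ = 1/4 < κ* ≈ 1.114`.
* `SlaveBookkeeping` (statement only; elementary) — the exponent arithmetic: the high-band (`k ≥ 1/(4μ)`) forcing of a curve analytic
  in a strip of width `η = c·ρ√Γ` is `≤ poly(Γ)·exp(−η/(4μ))`, which beats every polynomial loss (free-tail inverse `Γ^{O(1)}`,
  core-scale nonlinearity `Γ/μ³`, band weights): `C·Γ^p·exp(−c√Γ) ≤ Γ^{−q}` for `Γ ≥ Γ₀`.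

HONEST FRAMING: an abstract Banach-space lemma and two elementary real-analysis statements for a line on the ∃-side
deciding crux of a HYPOTHETICAL filament skeleton (negative-side MODEL route `FilamentSkeletonRss`); nothing here bears on
Navier–Stokes regularity or blow-up; 23610 / 23320 / 23612 stay OPEN.
-/

set_option linter.dupNamespace false

open Set Metric Filter Topology

namespace Summit.NavierStokesRegularity.NavierStokesRegularity.Cruxes.SkeletonJ1R.KelvinSlave

/-- THE KELVIN SLAVE (inner loop), abstract form: slice-Picard.  `R` is (in the application) a right inverse of the
linearisation of `Φ` on the band where `Φ` lives, so that `g ↦ Φ (R g) − g` is small-Lipschitz near `0`. -/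
def SlicePicard : Prop :=
  ∀ (E F : Type) [NormedAddCommGroup E] [NormedSpace ℝ E]
    [NormedAddCommGroup F] [NormedSpace ℝ F] [CompleteSpace F]
    (Φ : E → F) (R : F →L[ℝ] E) (ε : ℝ),
    0 ≤ ε → ‖Φ (R 0)‖ ≤ ε →
    (∀ g g' : F, ‖g‖ ≤ 2 * ε → ‖g'‖ ≤ 2 * ε →
        ‖(Φ (R g) - g) - (Φ (R g') - g')‖ ≤ (1 / 2) * ‖g - g'‖) →
    ∃ g : F, ‖g‖ ≤ 2 * ε ∧ Φ (R g) = 0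

/-- Slice-Picard is Banach's fixed-point theorem for `S g := g − Φ (R g)` on the closed ball of radius `2ε`. -/
theorem slicePicard_holds : SlicePicard := by
  intro E F _ _ _ _ _ Φ R ε hε h0 hlip
  set B : Set F := closedBall (0 : F) (2 * ε) with hBdef
  let S : F → F := fun g => g - Φ (R g)
  have hmemB : ∀ g : F, g ∈ B ↔ ‖g‖ ≤ 2 * ε := fun g => by
    simp [hBdef, mem_closedBall, dist_zero_right]
  -- Lipschitz estimate for S on B
  have hS : ∀ g ∈ B, ∀ g' ∈ B, ‖S g - S g'‖ ≤ (1 / 2) * ‖g - g'‖ := by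
    intro g hg g' hg'
    have h := hlip g g' ((hmemB g).1 hg) ((hmemB g').1 hg')
    have heq : S g - S g' = -((Φ (R g) - g) - (Φ (R g') - g')) := by
      simp only [S]; abel
    rw [heq, norm_neg]
    exact h
  -- S maps B into B
  have hmaps : MapsTo S B B := by
    intro g hg
    rw [hmemB] at hg ⊢
    have h0B : (0 : F) ∈ B := (hmemB 0).2 (by simpa using mul_nonneg (by norm_num : (0:ℝ) ≤ 2) hε)
    have h1 := hS g ((hmemB g).2 hg) 0 h0B
    have hS0 : ‖S 0‖ ≤ ε := by
      simp only [S, zero_sub, norm_neg]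
      exact h0
    calc ‖S g‖ = ‖(S g - S 0) + S 0‖ := by abel_nf
      _ ≤ ‖S g - S 0‖ + ‖S 0‖ := norm_add_le _ _
      _ ≤ (1 / 2) * ‖g - 0‖ + ε := add_le_add h1 hS0
      _ ≤ (1 / 2) * (2 * ε) + ε := by
            rw [sub_zero]; gcongr
      _ = 2 * ε := by ring
  -- contraction on the complete set B
  have hBc : IsComplete B := (isClosed_closedBall).isComplete
  have hK : LipschitzWith (1 / 2 : NNReal) (hmaps.restrict S B B) := by
    refine LipschitzWith.of_dist_le_mul fun x y => ?_
    have hx : (x : F) ∈ B := x.2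
    have hy : (y : F) ∈ B := y.2
    simp only [Subtype.dist_eq, dist_eq_norm, MapsTo.val_restrict_apply]
    have := hS x hx y hy
    push_cast
    linarith
  have hcw : ContractingWith (1 / 2 : NNReal) (hmaps.restrict S B B) := by
    refine ⟨?_, hK⟩
    rw [← NNReal.coe_lt_coe]
    push_cast
    norm_num
  have h0B : (0 : F) ∈ B := (hmemB 0).2 (by simpa using mul_nonneg (by norm_num : (0:ℝ) ≤ 2) hε)
  obtain ⟨y, hyB, hfix, -⟩ := ContractingWith.exists_fixedPoint' hBc hmaps hcw h0B (edist_ne_top _ _)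
  refine ⟨y, (hmemB y).1 hyB, ?_⟩
  have hy : y - Φ (R y) = y := hfix
  have : Φ (R y) = 0 := by
    have h2 : y - Φ (R y) - y = 0 := by rw [hy, sub_self]
    have h3 : y - Φ (R y) - y = -Φ (R y) := by abel
    rw [h3] at h2
    exact neg_eq_zero.1 h2
  exact this

open Summit.NavierStokesRegularity.NavierStokesRegularity.Theorems.AnalyticStripLiaSymbol in
/-- ZONE STRUCTURE OF THE EXACT SYMBOL used by the band split (Γ-free; all constants from landed window theorems).
(i) bending band `(0, 1/4]`: elliptic floor `x²/5 ≤ |liaSym x|`; (ii) Kelvin band `[1/4, ∞)`: every point lies in an algebraic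
zone (`liaSym ≤ −1/64` or `liaSym ≥ 1/50`) or in the transit window `[17/20, 18/5]` where `liaSym′ ≥ 153/4000` (this window
contains the simple zero `κ* ≈ 1.114` of the Kelvin multiplier `m = 2·liaSym`). -/
def BandSymbolFacts : Prop :=
  (∀ x : ℝ, 0 < x → x ≤ 1 / 4 → x ^ 2 / 5 ≤ |liaSym x|) ∧
  (∀ x : ℝ, 1 / 4 ≤ x →
      liaSym x ≤ -(1 / 64) ∨ (153 / 4000 ≤ deriv liaSym x ∧ 17 / 20 ≤ x ∧ x ≤ 18 / 5) ∨ 1 / 50 ≤ liaSym x)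

open Summit.NavierStokesRegularity.NavierStokesRegularity.Theorems.AnalyticStripLiaSymbol in
theorem bandSymbolFacts_holds : BandSymbolFacts := by
  refine ⟨fun x hx hx4 => ?_, fun x hx => ?_⟩
  · rcases le_or_gt x (1 / 10) with h | h
    · -- `(0, 1/10]`: `x²/4 · log(1/x) ≤ |liaSym x|` and `log(1/x) ≥ log 10 > 4/5`
      have hlow := abs_liaSym_ge_low x hx h
      have hlog : (4 : ℝ) / 5 ≤ Real.log (1 / x) := by
        have h10 : (10 : ℝ) ≤ 1 / x := by
          rw [le_div_iff₀ hx]; nlinarith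
        have hlog10 : Real.log 10 ≥ 2 := by
          have h2 : Real.log 2 > 0.6931471803 := Real.log_two_gt_d9
          have h8 : Real.log 8 = 3 * Real.log 2 := by
            rw [show (8:ℝ) = 2 ^ 3 by norm_num, Real.log_pow]; norm_num
          have hmono : Real.log 8 ≤ Real.log 10 := Real.log_le_log (by norm_num) (by norm_num)
          linarith
        have := Real.log_le_log (by norm_num : (0:ℝ) < 10) h10
        linarith
      have hx2 : 0 ≤ x ^ 2 / 4 := by positivity
      calc x ^ 2 / 5 ≤ x ^ 2 / 4 * (4 / 5) := by ring_nf; exact le_rfl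
        _ ≤ x ^ 2 / 4 * Real.log (1 / x) := mul_le_mul_of_nonneg_left hlog hx2
        _ ≤ |liaSym x| := hlow
    · -- `[1/10, 1/4]`: `liaSym x ≤ −x²/5`
      have hmid := liaSym_le_neg_mid_low x h.le hx4
      have hneg : liaSym x ≤ 0 := by nlinarith [sq_nonneg x]
      rw [abs_of_nonpos hneg]
      linarith
  · rcases le_or_gt x (19 / 20) with h1 | h1
    · exact Or.inl (liaSym_le_neg_window x hx h1)
    · rcases le_or_gt x (18 / 5) with h2 | h2
      · exact Or.inr (Or.inl ⟨deriv_liaSym_ge_band_const (by linarith) h2, by linarith, h2⟩)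
      · refine Or.inr (Or.inr (liaSym_ge_MID ?_))
        rw [abs_of_pos (by linarith)]
        linarith

/-- EXPONENT BOOKKEEPING of the band split (statement only): the `exp(−c√Γ)` smallness of the Kelvin-band forcing of a curve
analytic in a strip of width `≍ √Γ` beats every polynomial loss of the free-tail inverse, the nonlinearity and the band weights. -/
def SlaveBookkeeping : Prop :=
  ∀ C p q c : ℝ, 0 < C → 0 < c →
    ∃ Γ₀ : ℝ, 1 < Γ₀ ∧ ∀ Γ : ℝ, Γ₀ ≤ Γ →
      C * Γ ^ p * Real.exp (-(c * √Γ)) ≤ Γ ^ (-q)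

end Summit.NavierStokesRegularity.NavierStokesRegularity.Cruxes.SkeletonJ1R.KelvinSlave
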